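import Summits.QuantumFields.YangMills.Theorems.UnitScaleTiltProp7StubEXOfDisplayedRowsWWSE
import Summits.QuantumFields.YangMills.Theorems.UnitScaleTiltProp7StubEXOfDisplayedRowsWWECtrLift
import Summits.QuantumFields.YangMills.Theorems.UnitScaleTiltProp7StubEXByDensity
import HarnessLib

/-!
# «ROOTᵍ» — GUARD EDITION (L ≥ 5) of ✓`Prop7StubEXOfDisplayedRowsWWSECtrDLift.stubEX_of_displayedRows_wWSECtrD` (★★OWNER RULING №55∕№56, chair ★p1 g29 WORD №77 recipe; px13 g18 generator `guard_twin.py`).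
# Statement = the parent's VERBATIM except the ONE token-run `5 ≤ L →` inserted after `∀ (L : ℕ), 1 < L →` in (a) the conclusion, (b) the [B8] Thm 2 binder `hThm2S`, (c) the `hChartW` letter binder;
# every other letter, numeral and row VERBATIM.  Proof = the parent's with the callee replaced by ITS guard edition (+ the guarded∕totalised uses of Thm 2, see the theorem docstring).
# NOT the registered EX `stub_existenceMinimalOrbit` (all L > 1): «EX GUARDED (L ≥ 5) modulo the displayed letters»; crux 19200 AS REGISTERED stays OPEN (its L = 3 member ⟸ `hThm2S3` only);
# `--supports stmt-QuantumFields-19200 --as helper`; rung R3 = SU(2) YM₃ on T³ — NOT d = 4, NOT infinite volume, NOT a mass gap, NOT Clay.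

References: T. Bałaban, CMP **102** (1985) 277–309 [Balaban1985Variational] (Prop. 7 p.299, Prop. 6 p.295, (45)–(46) p.285, (112) p.294, (123)–(142) pp.296–299); CMP **98** (1985) 17–51
[Balaban1985Averaging] ((11)–(13) p.19, (89)–(92) p.31); [Balaban1985RegularSpaces] ((1.37) p.82, Thm 2 p.83); CMP **99** (1985) 389–434 [Balaban1985BackgroundPropagators] ((3.19)–(3.21) pp.393–394).
-/

set_option autoImplicit false

noncomputable section

open scoped BigOperators Matrix.Norms.L2Operator Matrix

namespace Summit.QuantumFields.YangMills.Theorems.Prop7StubEXOfDisplayedRowsWWSECtrDLiftG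

open Literature.MathematicalPhysics.QuantumFieldTheory.Balaban1983to89
open Literature.MathematicalPhysics.QuantumFieldTheory.Balaban1983to89.T3ContinuumYM3Torus
open Literature.MathematicalPhysics.QuantumFieldTheory.Balaban1983to89.T3UnitLawDensityEML (ℰp)
open Literature.MathematicalPhysics.QuantumFieldTheory.Balaban1983to89.T3ConstrainedMinimiser (fibre)
open Literature.MathematicalPhysics.QuantumFieldTheory.Balaban1983to89.T3PrintedRegularMinimiser (RegPr regFibrePr)
open Literature.MathematicalPhysics.QuantumFieldTheory.Balaban1983to89.T3PrintedRegularOrbits (descTransf)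
open Literature.MathematicalPhysics.QuantumFieldTheory.Balaban1983to89.T3Thm1Carrier
open Literature.MathematicalPhysics.QuantumFieldTheory.Balaban1983to89.T3SectALandauChart (In19 emb15 CloseAvg eta)
open BlockAveragingEMLLinearisedBackground (pertVar)
open B4Sect5Torus (TSite)
open B9SectCLatticeCarrier (Bond)
open B10Eq27TorusAxialLog (unitsField toUField)
open B11Eq115Space (NegSize Space115)
open B11Eq111FrakG (nabla115)
open B11Eq98CurrentSlot (Jcur)
open B13Contraction113 (QuadAnalytic)
open B8Thm2SetupTorus (Thm2SetupSUAt)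
open B7Prop2SpecialUnitary (specialUnitaryUnits)
open Summit.QuantumFields.YangMills.Theorems.Prop7TPrint (nMax19 expHermField)
open Summit.QuantumFields.YangMills.Theorems.Prop7SPrint (AvgCondPrint AvgCondPrintS NormS IsLandauPrint)
open Summit.QuantumFields.YangMills.Theorems.Prop7CovOfThm2 (cov_of_thm2SetupSUAt)
open Summit.QuantumFields.YangMills.Theorems.Prop7StubEXByDensity (existenceMinimalOrbit_of_CminG_covCtr_irrLift)
open Summit.QuantumFields.YangMills.Theorems.Prop7ClosedFibreHalving (existenceMinimalOrbit_allB₃_of_one)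

/-! ## §1 C-minˢ at `(L, B₃)` with the WINDOWED (1.37)-binder — from ✓`Cmin_of_P6T3_chart_growth_pd_S` at the windowed letter `Bf′` -/

variable {L : ℕ}

open Literature.MathematicalPhysics.QuantumFieldTheory.Balaban1983to89.T3PrintedMinimiserExistence (plaqSmall_of_le regPr_mono) in
/-- («AUX-2».) GUARD EDITION (L ≥ 5) of ✓`Prop7ClosedFibreHalving.existenceMinimalOrbit_allB₃_of_one`: `hone` and the conclusion guarded by `5 ≤ L →` after `1 < L →`;
proof = the parent's with `intro L hL h5 B₃ hB₃` and `hone L hL h5` (pointwise in `L`, so the guard rides through).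
[cite: Balaban1985Variational, Prop. 7 p.299, (7) p.278, (14) p.280] -/
theorem existenceMinimalOrbit_allB₃_of_oneG
    (hone : ∀ L : ℕ, 1 < L → 5 ≤ L → ∃ Bs a₁' O₁ : ℝ, 0 < Bs ∧ 0 < a₁' ∧ 1 ≤ O₁ ∧
      ∀ F : T3Family, F.L = L → ∀ (n K : ℕ) (hnK : n < K) (ε₁ : ℝ), 0 < ε₁ →
        ∀ V : GaugeField (F.P n) 0 (Matrix.specialUnitaryGroup (Fin 2) ℂ), PlaqSmall ε₁ V →
          ∀ U₀ : GaugeField (F.P K) 0 (Matrix.specialUnitaryGroup (Fin 2) ℂ), RegPr F n K ((L : ℝ) ^ 3 * Bs * ε₁) U₀ →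
            U₀ ∈ fibre F ℰp n K hnK.le V → ε₁ ≤ a₁' →
              ∃ U ∈ regFibrePr F n K hnK.le (O₁ * (L : ℝ) ^ 3 * Bs * ε₁) V,
                IsMinOn (fun W : GaugeField (F.P K) 0 (Matrix.specialUnitaryGroup (Fin 2) ℂ) => wilsonAction4 W)
                  (regFibrePr F n K hnK.le (O₁ * (L : ℝ) ^ 3 * Bs * ε₁) V) U) :
    ∀ L : ℕ, 1 < L → 5 ≤ L → ∀ B₃ : ℝ, 4 < B₃ → ∃ a₁' O₁ : ℝ, 0 < a₁' ∧ 1 ≤ O₁ ∧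
      ∀ F : T3Family, F.L = L → ∀ (n K : ℕ) (hnK : n < K) (ε₁ : ℝ), 0 < ε₁ →
        ∀ V : GaugeField (F.P n) 0 (Matrix.specialUnitaryGroup (Fin 2) ℂ), PlaqSmall ε₁ V →
          ∀ U₀ : GaugeField (F.P K) 0 (Matrix.specialUnitaryGroup (Fin 2) ℂ), RegPr F n K ((L : ℝ) ^ 3 * B₃ * ε₁) U₀ →
            U₀ ∈ fibre F ℰp n K hnK.le V → ε₁ ≤ a₁' →
              ∃ U ∈ regFibrePr F n K hnK.le (O₁ * (L : ℝ) ^ 3 * B₃ * ε₁) V,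
                IsMinOn (fun W : GaugeField (F.P K) 0 (Matrix.specialUnitaryGroup (Fin 2) ℂ) => wilsonAction4 W)
                  (regFibrePr F n K hnK.le (O₁ * (L : ℝ) ^ 3 * B₃ * ε₁) V) U := by
  intro L hL h5 B₃ hB₃
  obtain ⟨Bs, a₁', O₁, hBs, ha₁', hO₁, H⟩ := hone L hL h5
  have hB₃0 : 0 < B₃ := by linarith
  have hL0 : (0 : ℝ) < (L : ℝ) := by exact_mod_cast (show 0 < L by omega)
  have hq : 0 < Bs / B₃ := div_pos hBs hB₃0
  have hBs0 : Bs ≠ 0 := hBs.ne'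
  have hB₃ne : B₃ ≠ 0 := hB₃0.ne'
  refine ⟨a₁' * min 1 (Bs / B₃), O₁ * max 1 (Bs / B₃), mul_pos ha₁' (lt_min one_pos hq),
    one_le_mul_of_one_le_of_one_le hO₁ (le_max_left _ _), ?_⟩
  intro F hF n K hnK ε₁ hε₁ V hV U₀ hreg hfib hε₁a
  rcases le_or_gt Bs B₃ with hle | hlt
  · -- `B₃ ≥ B₃*`: read the (7)-datum at `ε₁* = B₃ε₁/B₃* ≥ ε₁`
    have hq1 : Bs / B₃ ≤ 1 := (div_le_one hB₃0).2 hle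
    have hmin1 : min 1 (Bs / B₃) = Bs / B₃ := min_eq_right hq1
    have hmax1 : max 1 (Bs / B₃) = 1 := max_eq_left hq1
    have hε₁s : 0 < B₃ * ε₁ / Bs := by positivity
    have hε₁le : ε₁ ≤ B₃ * ε₁ / Bs := by
      rw [le_div_iff₀ hBs]; nlinarith
    have hVs : PlaqSmall (B₃ * ε₁ / Bs) V := plaqSmall_of_le hε₁le hV
    have hε₁sa : B₃ * ε₁ / Bs ≤ a₁' := by
      rw [hmin1] at hε₁a
      rw [div_le_iff₀ hBs]
      have := mul_le_mul_of_nonneg_left hε₁a hB₃0.le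
      calc B₃ * ε₁ ≤ B₃ * (a₁' * (Bs / B₃)) := this
        _ = a₁' * Bs := by field_simp
    have hrad0 : (L : ℝ) ^ 3 * Bs * (B₃ * ε₁ / Bs) = (L : ℝ) ^ 3 * B₃ * ε₁ := by field_simp
    have hregs : RegPr F n K ((L : ℝ) ^ 3 * Bs * (B₃ * ε₁ / Bs)) U₀ := by rw [hrad0]; exact hreg
    obtain ⟨U, hU, hUmin⟩ := H F hF n K hnK (B₃ * ε₁ / Bs) hε₁s V hVs U₀ hregs hfib hε₁sa
    have hrad : O₁ * (L : ℝ) ^ 3 * Bs * (B₃ * ε₁ / Bs) = O₁ * max 1 (Bs / B₃) * (L : ℝ) ^ 3 * B₃ * ε₁ := by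
      rw [hmax1]; field_simp
    rw [hrad] at hU hUmin
    exact ⟨U, hU, hUmin⟩
  · -- `B₃ < B₃*`: enlarge `O₁` by `B₃*/B₃` and use `𝔘_k(L³B₃ε₁) ⊆ 𝔘_k(L³B₃*ε₁)`
    have hq1 : 1 ≤ Bs / B₃ := (one_le_div hB₃0).2 hlt.le
    have hmin1 : min 1 (Bs / B₃) = 1 := min_eq_left hq1
    have hmax1 : max 1 (Bs / B₃) = Bs / B₃ := max_eq_right hq1
    rw [hmin1, mul_one] at hε₁a
    have hmono : (L : ℝ) ^ 3 * B₃ * ε₁ ≤ (L : ℝ) ^ 3 * Bs * ε₁ := by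
      have : 0 ≤ (L : ℝ) ^ 3 * ε₁ := by positivity
      nlinarith
    obtain ⟨U, hU, hUmin⟩ := H F hF n K hnK ε₁ hε₁ V hV U₀ (regPr_mono F hmono hreg) hfib hε₁a
    have hrad : O₁ * (L : ℝ) ^ 3 * Bs * ε₁ = O₁ * max 1 (Bs / B₃) * (L : ℝ) ^ 3 * B₃ * ε₁ := by
      rw [hmax1]; field_simp
    rw [hrad] at hU hUmin
    exact ⟨U, hU, hUmin⟩

/-- («ROOTᵍ».) GUARD EDITION (L ≥ 5) of ✓`Prop7StubEXOfDisplayedRowsWWSECtrDLift.stubEX_of_displayedRows_wWSECtrD`: the parent's statement VERBATIM except `5 ≤ L →` inserted after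
`∀ (L : ℕ), 1 < L →` in the conclusion and in the binder `hThm2S`, (c) the `hChartW` letter binder; proof = the parent's over the guard edition of its callee.
NOT the registered EX (all L > 1) — «EX GUARDED (L ≥ 5) modulo the displayed letters»; CONDITIONAL on every displayed letter.
[cite: Balaban1985Variational, Prop. 7 p.299, Prop. 6 p.295, (112) p.294, (141)-(142) p.299, (47) p.285; Balaban1985RegularSpaces, Thm 2 p.83, (1.37) p.82, (1.28)-(1.30) p.81] -/
theorem stubEX_of_displayedRows_wWSECtrDG
    [hFL : ∀ F : T3Family, Fact (0 < (F.L : ℝ))] [hFη : ∀ (F : T3Family) (k : ℕ), Fact (0 < ((F.L : ℝ)⁻¹) ^ k)]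
    (Lan : ∀ (L : ℕ) (i : Idx L), GaugeField (i.1.1.P i.1.2.2) 0 (Matrix.specialUnitaryGroup (Fin 2) ℂ) → (PBond (i.1.1.P i.1.2.2) 0 → Matrix (Fin 2) (Fin 2) ℂ) → Prop)
    -- the LIFT antecedent of the S7′ chain, OPAQUE `L`- and member-indexed predicate (like `Lan`; ★px14 (T1)(T2) design, EX namer REVIEW PASS 21:59:22Z; text of record fixed only at the display)
    (Lift : ∀ (L : ℕ) (i : Idx L), GaugeField (i.1.1.P i.1.2.2) 0 (Matrix.specialUnitaryGroup (Fin 2) ℂ) → Prop)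
    (Pd : ∀ (L : ℕ) (i : Idx L), Fin (i.1.1.P i.1.2.2).d → ℕ) (e : ∀ (L : ℕ) (i : Idx L), Site (i.1.1.P i.1.2.2) 0 ≃ TSite (i.1.1.P i.1.2.2).d (Pd L i))
    (he : ∀ (L : ℕ) (i : Idx L) (x : Site (i.1.1.P i.1.2.2) 0) (μ : Fin (i.1.1.P i.1.2.2).d), e L i (x.shift μ) = B9Eq33CovDerivVector.shiftEquiv μ (e L i x))
    -- the constants, member-uniform at each `L` (print: «absolute constants depending on d and L only»)
    (B₀ C₄ a₃ α r M aW : ℕ → ℝ) (hB₀ : ∀ L, 1 < L → 0 < B₀ L) (hC₄ : ∀ L, 1 < L → 0 < C₄ L) (ha₃ : ∀ L, 1 < L → 0 < a₃ L)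
    (hα : ∀ L, 1 < L → 0 < α L) (hr : ∀ L, 1 < L → 0 < r L) (haW : ∀ L, 1 < L → 0 < aW L)
    -- the curved letters, OPAQUE
    (𝒢f : ∀ (L : ℕ) (i : Idx L) (U₀ : GaugeField (i.1.1.P i.1.2.2) 0 (Matrix.specialUnitaryGroup (Fin 2) ℂ)),
      NegSize (i.1.1.L : ℝ) (((i.1.1.L : ℝ)⁻¹) ^ (i.1.2.2 - i.1.2.1)) (fun _ : Bond (i.1.1.P i.1.2.2).d (Pd L i) => i.1.2.2 - i.1.2.1) 3
          (Matrix (Fin 2) (Fin 2) ℂ) →L[ℂ]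
        Space115 (i.1.1.L : ℝ) (((i.1.1.L : ℝ)⁻¹) ^ (i.1.2.2 - i.1.2.1)) (fun _ : Bond (i.1.1.P i.1.2.2).d (Pd L i) => i.1.2.2 - i.1.2.1)
          (fun _ : Bond (i.1.1.P i.1.2.2).d (Pd L i) × Fin (i.1.1.P i.1.2.2).d => i.1.2.2 - i.1.2.1) (nabla115 (((i.1.1.L : ℝ)⁻¹) ^ (i.1.2.2 - i.1.2.1)) (fun b : Bond (i.1.1.P i.1.2.2).d (Pd L i) => unitsField (toUField U₀) ⟨(e L i).symm b.1, b.2⟩)))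
    (Wf : ∀ (L : ℕ) (i : Idx L) (U₀ : GaugeField (i.1.1.P i.1.2.2) 0 (Matrix.specialUnitaryGroup (Fin 2) ℂ)),
      Space115 (i.1.1.L : ℝ) (((i.1.1.L : ℝ)⁻¹) ^ (i.1.2.2 - i.1.2.1)) (fun _ : Bond (i.1.1.P i.1.2.2).d (Pd L i) => i.1.2.2 - i.1.2.1)
          (fun _ : Bond (i.1.1.P i.1.2.2).d (Pd L i) × Fin (i.1.1.P i.1.2.2).d => i.1.2.2 - i.1.2.1) (nabla115 (((i.1.1.L : ℝ)⁻¹) ^ (i.1.2.2 - i.1.2.1)) (fun b : Bond (i.1.1.P i.1.2.2).d (Pd L i) => unitsField (toUField U₀) ⟨(e L i).symm b.1, b.2⟩)) →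
        NegSize (i.1.1.L : ℝ) (((i.1.1.L : ℝ)⁻¹) ^ (i.1.2.2 - i.1.2.1)) (fun _ : Bond (i.1.1.P i.1.2.2).d (Pd L i) => i.1.2.2 - i.1.2.1) 3 (Matrix (Fin 2) (Fin 2) ℂ))
    (β : ∀ L : ℕ, Idx L → Type) [∀ (L : ℕ) (i : Idx L), Fintype (β L i)]
    (H₁f : ∀ (L : ℕ) (i : Idx L) (U₀ : GaugeField (i.1.1.P i.1.2.2) 0 (Matrix.specialUnitaryGroup (Fin 2) ℂ)),
      (β L i → Matrix (Fin 2) (Fin 2) ℂ) →L[ℂ]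
        Space115 (i.1.1.L : ℝ) (((i.1.1.L : ℝ)⁻¹) ^ (i.1.2.2 - i.1.2.1)) (fun _ : Bond (i.1.1.P i.1.2.2).d (Pd L i) => i.1.2.2 - i.1.2.1)
          (fun _ : Bond (i.1.1.P i.1.2.2).d (Pd L i) × Fin (i.1.1.P i.1.2.2).d => i.1.2.2 - i.1.2.1) (nabla115 (((i.1.1.L : ℝ)⁻¹) ^ (i.1.2.2 - i.1.2.1)) (fun b : Bond (i.1.1.P i.1.2.2).d (Pd L i) => unitsField (toUField U₀) ⟨(e L i).symm b.1, b.2⟩)))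
    (Bf : ∀ (L : ℕ) (i : Idx L), GaugeField (i.1.1.P i.1.2.1) 0 (Matrix.specialUnitaryGroup (Fin 2) ℂ) → GaugeField (i.1.1.P i.1.2.2) 0 (Matrix.specialUnitaryGroup (Fin 2) ℂ) →
      β L i → Matrix (Fin 2) (Fin 2) ℂ)
    -- the slice at the critical background `W`, OPAQUE (sizes included)
    (Tsl : ∀ (L : ℕ) (i : Idx L), GaugeField (i.1.1.P i.1.2.2) 0 (Matrix.specialUnitaryGroup (Fin 2) ℂ) → Set (PBond (i.1.1.P i.1.2.2) 0 → Matrix (Fin 2) (Fin 2) ℂ))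
    -- their displayed bounds (the `SectEDatum` fields at admissible backgrounds)
    (norm_G : ∀ (L : ℕ), 1 < L → ∀ (i : Idx L) (ρ : ℝ) (U₀ : GaugeField (i.1.1.P i.1.2.2) 0 (Matrix.specialUnitaryGroup (Fin 2) ℂ)),
      RegPr i.1.1 i.1.2.1 i.1.2.2 ρ U₀ → ρ ≤ α L → Lift L i U₀ → ∀ f, ‖𝒢f L i U₀ f‖ ≤ B₀ L * ‖f‖)
    (prop4 : ∀ (L : ℕ), 1 < L → ∀ (i : Idx L) (ρ : ℝ) (U₀ : GaugeField (i.1.1.P i.1.2.2) 0 (Matrix.specialUnitaryGroup (Fin 2) ℂ)),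
      RegPr i.1.1 i.1.2.1 i.1.2.2 ρ U₀ → ρ ≤ α L → Lift L i U₀ → QuadAnalytic (Wf L i U₀) (C₄ L) (a₃ L))
    (norm_H₁ : ∀ (L : ℕ), 1 < L → ∀ (i : Idx L) (ρ : ℝ) (U₀ : GaugeField (i.1.1.P i.1.2.2) 0 (Matrix.specialUnitaryGroup (Fin 2) ℂ)),
      RegPr i.1.1 i.1.2.1 i.1.2.2 ρ U₀ → ρ ≤ α L → Lift L i U₀ → ∀ b, ‖H₁f L i U₀ b‖ ≤ B₀ L * ‖b‖)
    -- (B20), WINDOWED at `B₃* = 3L`: asked only on the admissible class `L³·(3L)·ε₁ ≤ α L`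
    (bound20 : ∀ (L : ℕ), 1 < L → ∀ (i : Idx L) (ε₁ : ℝ) (V : GaugeField (i.1.1.P i.1.2.1) 0 (Matrix.specialUnitaryGroup (Fin 2) ℂ))
      (U₀ : GaugeField (i.1.1.P i.1.2.2) 0 (Matrix.specialUnitaryGroup (Fin 2) ℂ)), 0 < ε₁ → PlaqSmall ε₁ V →
      RegPr i.1.1 i.1.2.1 i.1.2.2 ((L : ℝ) ^ 3 * (3 * (L : ℝ)) * ε₁) U₀ → CloseAvg i.1.1 i.1.2.1 i.1.2.2 i.2.2.le ((L : ℝ) ^ 3 * ε₁) V U₀ →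
      (L : ℝ) ^ 3 * (3 * (L : ℝ)) * ε₁ ≤ α L →
      ‖Bf L i V U₀‖ < 2 * ((3 : ℝ) * i.1.1.L) * ((L : ℝ) ^ 3 * ε₁))
    -- (i) CHART-112, displayed
    (hChart : ∀ (L : ℕ), 1 < L → ∀ (i : Idx L) (ε₁ : ℝ) (V : GaugeField (i.1.1.P i.1.2.1) 0 (Matrix.specialUnitaryGroup (Fin 2) ℂ))
      (U₀ : GaugeField (i.1.1.P i.1.2.2) 0 (Matrix.specialUnitaryGroup (Fin 2) ℂ)), 0 < ε₁ → PlaqSmall ε₁ V →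
      RegPr i.1.1 i.1.2.1 i.1.2.2 ((L : ℝ) ^ 3 * (3 * (L : ℝ)) * ε₁) U₀ → CloseAvg i.1.1 i.1.2.1 i.1.2.2 i.2.2.le ((L : ℝ) ^ 3 * ε₁) V U₀ → Lift L i U₀ → (L : ℝ) ^ 3 * (3 * (L : ℝ)) * ε₁ ≤ α L →
      ∀ A₁ : Space115 (i.1.1.L : ℝ) (((i.1.1.L : ℝ)⁻¹) ^ (i.1.2.2 - i.1.2.1)) (fun _ : Bond (i.1.1.P i.1.2.2).d (Pd L i) => i.1.2.2 - i.1.2.1)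
          (fun _ : Bond (i.1.1.P i.1.2.2).d (Pd L i) × Fin (i.1.1.P i.1.2.2).d => i.1.2.2 - i.1.2.1) (nabla115 (((i.1.1.L : ℝ)⁻¹) ^ (i.1.2.2 - i.1.2.1)) (fun b : Bond (i.1.1.P i.1.2.2).d (Pd L i) => unitsField (toUField U₀) ⟨(e L i).symm b.1, b.2⟩)),
        ‖A₁‖ < r L → A₁ + 𝒢f L i U₀ (Jcur (fun b : Bond (i.1.1.P i.1.2.2).d (Pd L i) => unitsField (toUField U₀) ⟨(e L i).symm b.1, b.2⟩)) + 𝒢f L i U₀ (Wf L i U₀ (A₁ + H₁f L i U₀ (Bf L i V U₀))) = 0 →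
        ∃ X : PBond (i.1.1.P i.1.2.2) 0 → Matrix (Fin 2) (Fin 2) ℂ,
          (∀ b : PBond (i.1.1.P i.1.2.2) 0, (X b).IsHermitian ∧ Matrix.trace (X b) = 0) ∧
          nMax19 i.1.1 i.1.2.1 i.1.2.2 U₀ X ≤ M L * ((L : ℝ) ^ 3 * (3 * (L : ℝ)) * ε₁) ∧
          AvgCondPrintS i.1.1 i.1.2.1 i.1.2.2 i.2.2.le V U₀ X ∧ Lan L i U₀ X ∧
          (∀ u : GaugeTransf (i.1.1.P i.1.2.2) 0 (Matrix.specialUnitaryGroup (Fin 2) ℂ), NormS i.1.1 i.1.2.1 i.1.2.2 i.2.2.le U₀ X (expHermField X) u →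
            GaugeField.gaugeAct u (emb15 U₀ (expHermField X)) ∈ fibre i.1.1 ℰp i.1.2.1 i.1.2.2 i.2.2.le V →
            ∀ γ : ℝ → GaugeField (i.1.1.P i.1.2.2) 0 (Matrix.specialUnitaryGroup (Fin 2) ℂ), γ 0 = GaugeField.gaugeAct u (emb15 U₀ (expHermField X)) →
              (∀ t, γ t ∈ fibre i.1.1 ℰp i.1.2.1 i.1.2.2 i.2.2.le V) →
              (∀ b, DifferentiableAt ℝ (fun t => ((γ t b : Matrix.specialUnitaryGroup (Fin 2) ℂ) : Matrix (Fin 2) (Fin 2) ℂ)) 0) →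
                deriv (fun t => wilsonAction4 (γ t)) 0 = 0))
    -- (ii-a) CHART_W at the critical background `W = (e^{iX}U₀)^u`: every admissible competitor has the action of a chart point `e^{iD}W`, `D` in the slice `Tsl L i W` (all size information lives in
    -- the opaque slice letter) — [Balaban1985RegularSpaces] Thm 2 + (47) at background `W` + gauge invariance of (5), DISPLAYED
    (hChartW : ∀ (L : ℕ), 1 < L → 5 ≤ L → ∀ (i : Idx L) (ε₁ ε₄ : ℝ) (V : GaugeField (i.1.1.P i.1.2.1) 0 (Matrix.specialUnitaryGroup (Fin 2) ℂ))
      (U₀ : GaugeField (i.1.1.P i.1.2.2) 0 (Matrix.specialUnitaryGroup (Fin 2) ℂ)) (X : PBond (i.1.1.P i.1.2.2) 0 → Matrix (Fin 2) (Fin 2) ℂ)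
      (u : GaugeTransf (i.1.1.P i.1.2.2) 0 (Matrix.specialUnitaryGroup (Fin 2) ℂ)) (W : GaugeField (i.1.1.P i.1.2.2) 0 (Matrix.specialUnitaryGroup (Fin 2) ℂ)),
      0 < ε₁ → ε₄ ≤ 1 / 4 → ε₄ ≤ aW L → (L : ℝ) ^ 3 * (3 * (L : ℝ)) * ε₁ ≤ ε₄ → PlaqSmall ε₁ V → RegPr i.1.1 i.1.2.1 i.1.2.2 ((L : ℝ) ^ 3 * (3 * (L : ℝ)) * ε₁) U₀ →
      CloseAvg i.1.1 i.1.2.1 i.1.2.2 i.2.2.le ((L : ℝ) ^ 3 * ε₁) V U₀ → (∀ b : PBond (i.1.1.P i.1.2.2) 0, (X b).IsHermitian ∧ Matrix.trace (X b) = 0) →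
      nMax19 i.1.1 i.1.2.1 i.1.2.2 U₀ X < ε₄ → AvgCondPrintS i.1.1 i.1.2.1 i.1.2.2 i.2.2.le V U₀ X → Lan L i U₀ X →
      NormS i.1.1 i.1.2.1 i.1.2.2 i.2.2.le U₀ X (expHermField X) u → W = GaugeField.gaugeAct u (emb15 U₀ (expHermField X)) →
      W ∈ fibre i.1.1 ℰp i.1.2.1 i.1.2.2 i.2.2.le V →
      (∀ γ : ℝ → GaugeField (i.1.1.P i.1.2.2) 0 (Matrix.specialUnitaryGroup (Fin 2) ℂ), γ 0 = W → (∀ t, γ t ∈ fibre i.1.1 ℰp i.1.2.1 i.1.2.2 i.2.2.le V) →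
        (∀ b, DifferentiableAt ℝ (fun t => ((γ t b : Matrix.specialUnitaryGroup (Fin 2) ℂ) : Matrix (Fin 2) (Fin 2) ℂ)) 0) →
          deriv (fun t => wilsonAction4 (γ t)) 0 = 0) →
      ∀ X' : PBond (i.1.1.P i.1.2.2) 0 → Matrix (Fin 2) (Fin 2) ℂ, nMax19 i.1.1 i.1.2.1 i.1.2.2 U₀ X' < ε₄ →
        (∀ b : PBond (i.1.1.P i.1.2.2) 0, (X' b).IsHermitian ∧ Matrix.trace (X' b) = 0) →
          AvgCondPrint i.1.1 i.1.2.1 i.1.2.2 i.2.2.le V U₀ X' → IsLandauPrint i.1.1 i.1.2.1 i.1.2.2 U₀ X' →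
            ∃ D ∈ Tsl L i W, (∀ b : PBond (i.1.1.P i.1.2.2) 0, (D b).IsHermitian ∧ Matrix.trace (D b) = 0) ∧
              wilsonAction4 (emb15 U₀ (expHermField X')) = wilsonAction4 (emb15 W (expHermField D)))
    -- (ii-b) LOCMIN_W: `W` is a minimum of the action along the charted slice — (141)–(142) at the critical background: first variation = 0 on the linear slice, second variation
    -- `½⟨A′, Δ₁A′⟩` positive definite, third order absorbed (DISPLAYED; the α-P lane's row: TAYLOR ∧ EL_W ∧ HESS_W in their scale-aware shapes ⟹ LOCMIN_W)
    (hLocW : ∀ (L : ℕ), 1 < L → ∀ (i : Idx L) (ε₁ ε₄ : ℝ) (V : GaugeField (i.1.1.P i.1.2.1) 0 (Matrix.specialUnitaryGroup (Fin 2) ℂ))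
      (U₀ : GaugeField (i.1.1.P i.1.2.2) 0 (Matrix.specialUnitaryGroup (Fin 2) ℂ)) (X : PBond (i.1.1.P i.1.2.2) 0 → Matrix (Fin 2) (Fin 2) ℂ)
      (u : GaugeTransf (i.1.1.P i.1.2.2) 0 (Matrix.specialUnitaryGroup (Fin 2) ℂ)) (W : GaugeField (i.1.1.P i.1.2.2) 0 (Matrix.specialUnitaryGroup (Fin 2) ℂ)),
      0 < ε₁ → ε₄ ≤ 1 / 4 → ε₄ ≤ aW L → (L : ℝ) ^ 3 * (3 * (L : ℝ)) * ε₁ ≤ ε₄ → PlaqSmall ε₁ V → RegPr i.1.1 i.1.2.1 i.1.2.2 ((L : ℝ) ^ 3 * (3 * (L : ℝ)) * ε₁) U₀ →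
      CloseAvg i.1.1 i.1.2.1 i.1.2.2 i.2.2.le ((L : ℝ) ^ 3 * ε₁) V U₀ → (∀ b : PBond (i.1.1.P i.1.2.2) 0, (X b).IsHermitian ∧ Matrix.trace (X b) = 0) →
      nMax19 i.1.1 i.1.2.1 i.1.2.2 U₀ X < ε₄ → AvgCondPrintS i.1.1 i.1.2.1 i.1.2.2 i.2.2.le V U₀ X → Lan L i U₀ X →
      NormS i.1.1 i.1.2.1 i.1.2.2 i.2.2.le U₀ X (expHermField X) u → W = GaugeField.gaugeAct u (emb15 U₀ (expHermField X)) →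
      W ∈ fibre i.1.1 ℰp i.1.2.1 i.1.2.2 i.2.2.le V →
      (∀ γ : ℝ → GaugeField (i.1.1.P i.1.2.2) 0 (Matrix.specialUnitaryGroup (Fin 2) ℂ), γ 0 = W → (∀ t, γ t ∈ fibre i.1.1 ℰp i.1.2.1 i.1.2.2 i.2.2.le V) →
        (∀ b, DifferentiableAt ℝ (fun t => ((γ t b : Matrix.specialUnitaryGroup (Fin 2) ℂ) : Matrix (Fin 2) (Fin 2) ℂ)) 0) →
          deriv (fun t => wilsonAction4 (γ t)) 0 = 0) →
      ∀ D ∈ Tsl L i W, (∀ b : PBond (i.1.1.P i.1.2.2) 0, (D b).IsHermitian ∧ Matrix.trace (D b) = 0) →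
        wilsonAction4 W ≤ wilsonAction4 (emb15 W (expHermField D)))
    -- ★★OWNER RULING g28-№8 (B) «DENSITY» (insurance line, pen px10 g3): THE IRREDUCIBLE-LIFT ROW `hIrrLift` (DISPLAYED, `Lift` opaque) IN THE PLACE OF SYM-CENTRE-R's `hSymCentre`: for `ε₁ ≤ aI L`,
    -- over an IRREDUCIBLE datum `V` (every `V`-parallel `M₂(ℂ)`-valued site section is scalar) every printed-regular `U₀ ∈ 𝔅_k(V)` of radius `L³·3L·ε₁` carries the lift `Lift L i U₀` — a THEOREM
    -- at the `Lift` text of record (✓p675347 `Prop7StubEXOfDensityLift.irrLift_T3`); below, MIN-MACRO on the dense irreducible sector (✓p675282) passes to every datum by the limit lemma ✓p674041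
    -- through the locally-onto descent ✓p676926 (spine ✓`Prop7StubEXByDensity.existenceMinimalOrbit_of_CminG_covCtr_irrLift`)
    (hIrrLift : ∀ (L : ℕ), 1 < L → ∃ aI : ℝ, 0 < aI ∧ ∀ (i : Idx L) (ε₁ : ℝ), 0 < ε₁ → ε₁ ≤ aI →
        ∀ (V : GaugeField (i.1.1.P i.1.2.1) 0 (Matrix.specialUnitaryGroup (Fin 2) ℂ)) (U₀ : GaugeField (i.1.1.P i.1.2.2) 0 (Matrix.specialUnitaryGroup (Fin 2) ℂ)),
          (∀ cf : Site (i.1.1.P i.1.2.1) 0 → Matrix (Fin 2) (Fin 2) ℂ,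
              (∀ b : PBond (i.1.1.P i.1.2.1) 0, cf b.src * ((V b : Matrix.specialUnitaryGroup (Fin 2) ℂ) : Matrix (Fin 2) (Fin 2) ℂ) =
                ((V b : Matrix.specialUnitaryGroup (Fin 2) ℂ) : Matrix (Fin 2) (Fin 2) ℂ) * cf b.tgt) →
              ∃ z : ℂ, ∀ y : Site (i.1.1.P i.1.2.1) 0, cf y = z • (1 : Matrix (Fin 2) (Fin 2) ℂ)) →
          PlaqSmall ε₁ V → RegPr i.1.1 i.1.2.1 i.1.2.2 ((L : ℝ) ^ 3 * (3 * (L : ℝ)) * ε₁) U₀ → U₀ ∈ fibre i.1.1 ℰp i.1.2.1 i.1.2.2 i.2.2.le V → Lift L i U₀)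
    -- (T2) the [B8] Thm 2 sockets AT THE SETUP-TORUS OBJECTS (`Thm2SetupSUAt`, rider dropped), one `(B₁, c₁)` per `L` — the weakest currency both consumers need
    (hThm2S : ∀ (L : ℕ), 1 < L → 5 ≤ L → ∃ B₁ c₁ : ℝ, 0 < B₁ ∧ 0 < c₁ ∧ ∀ (F : T3Family), F.L = L → ∀ (n K : ℕ), n < K →
      ∃ (β₀ B₂ : ℝ) (len : B7Prop1Explicit.Site (F.P K).d → ℝ),
        Thm2SetupSUAt (F.P K) 2 (K - n) (eta F n K) β₀ B₁ B₂ c₁ len (fun _ => True)) :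
    ∀ (L : ℕ), 1 < L → 5 ≤ L → ∀ (B₃ : ℝ), 4 < B₃ → ∃ a₁' O₁ : ℝ, 0 < a₁' ∧ 1 ≤ O₁ ∧
    ∀ (F : T3Family), F.L = L → ∀ (n K : ℕ) (hnK : n < K) (ε₁ : ℝ), 0 < ε₁ →
      ∀ V : GaugeField (F.P n) 0 (Matrix.specialUnitaryGroup (Fin 2) ℂ), PlaqSmall ε₁ V →
        ∀ U₀ : GaugeField (F.P K) 0 (Matrix.specialUnitaryGroup (Fin 2) ℂ), RegPr F n K ((L : ℝ) ^ 3 * B₃ * ε₁) U₀ → U₀ ∈ fibre F ℰp n K hnK.le V →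
          ε₁ ≤ a₁' → ∃ U ∈ regFibrePr F n K hnK.le (O₁ * (L : ℝ) ^ 3 * B₃ * ε₁) V,
            IsMinOn (fun W : GaugeField (F.P K) 0 (Matrix.specialUnitaryGroup (Fin 2) ℂ) => wilsonAction4 W)
              (regFibrePr F n K hnK.le (O₁ * (L : ℝ) ^ 3 * B₃ * ε₁) V) U := by
  refine existenceMinimalOrbit_allB₃_of_oneG fun L hL h5 => ?_
  have hL0 : (0 : ℝ) < (L : ℝ) := by exact_mod_cast (show 0 < L by omega)
  have hL2 : (2 : ℝ) ≤ (L : ℝ) := by exact_mod_cast (show 2 ≤ L by omega)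
  have h3L4 : (4 : ℝ) < 3 * (L : ℝ) := by linarith
  obtain ⟨B₁, c₁, hB₁, hc₁, hT⟩ := hThm2S L hL h5
  have hCOV := cov_of_thm2SetupSUAt (L := L) (B₃ := 3 * (L : ℝ)) (by positivity) hB₁ hc₁ hT
  have hCmin := Prop7StubEXOfDisplayedRowsWWECtrLift.Cmin_of_P6T3_chart_locmin_pd_wWECtr hL (le_refl (3 * (L : ℝ))) (Lan L) (Lift L) (Pd L) (e L) (he L) (hB₀ L hL) (hC₄ L hL) (ha₃ L hL) (hα L hL) (hr L hL)
    (haW L hL) (𝒢f L) (Wf L) (β L) (H₁f L) (Bf L) (Tsl L) (norm_G L hL) (prop4 L hL) (norm_H₁ L hL) (bound20 L hL) (hChart L hL)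
    (hChartW L hL h5) (hLocW L hL)
  obtain ⟨a₁', O₁, ha₁', hO₁, H⟩ := existenceMinimalOrbit_of_CminG_covCtr_irrLift hL h3L4 (Lan L) (Lift L) hCmin hCOV (hIrrLift L hL)
  exact ⟨3 * (L : ℝ), a₁', O₁, by positivity, ha₁', hO₁, H⟩

end Summit.QuantumFields.YangMills.Theorems.Prop7StubEXOfDisplayedRowsWWSECtrDLiftG

end
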